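import Summits.CriticalPhenomena.CardyFormulaZ2.Theorems.CardyUSTContinuationKirchhoffExtremalLengthG02BdryKey
import Summits.CriticalPhenomena.CardyFormulaZ2.Theorems.CardyUSTContinuationKirchhoffExtremalLengthG02Exit
import Summits.CriticalPhenomena.CardyFormulaZ2.Theorems.CardyUSTContinuationKirchhoffExtremalLengthG02Holo2

/-!
# Boundary values of the limit of the discrete conjugates (G02 discretisation)

Support file for `KirchhoffExtremalLength` (route CardyUSTContinuation of `CardyFormulaZ2`, item
stmt-CriticalPhenomena-11234), towards the upper half of `G02ModulusConvergence` (`…Defs.lean`).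
Transposition of the tree's `SquareTiling.exists_boundary_value` ([GP19] §3 with the dual form
of Lemma 4.8) to `Ω_δ = discreteDomainGraph Ω δ`: for meshes `δ_n → 0⁺`, potentials `h_n` and
their conjugates `facePot` based at the face of `c⋆ ∈ Ω`, converging locally uniformly to `u`,
and a boundary point `q` away from the Dirichlet arcs, the common virtual value `c_n` of the
exits near `q` converges, to the boundary value of `u` at `q`. For `Ω_δ` the equality of the exit
values near `q` (`faceExitVal_eq_faceExitVal`) is fed the flux-free walk through the exterior of
`exists_fluxFree_walk_near` (uniform local connectedness of the exterior, `exists_ulc_radius`)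
instead of the shadow of a short boundary arc, and the inner estimate is
`abs_facePot_sub_faceExitVal_le_of_near`.
-/

noncomputable section

namespace Summit.CriticalPhenomena.CardyFormulaZ2.Theorems

namespace KirchhoffSlope

open Set Metric Filter Topology SimpleGraph
open Literature.Probability Literature.Probability.LatticeModels Literature.Probability.Percolation
open Literature.Probability.LatticeModels.SquareTiling (closedSq floorSq mem_closedSq_floorSq meshPoint_mem_closedSq
  dist_le_of_mem_closedSq)
open Literature.Probability.RandomPlanarGeometry

open WeakBeurling

set_option maxHeartbeats 1600000 in
open Classical in
/-- **Boundary values of the conjugates' limit.** Setting: meshes `δ_n → 0`, potentials `h_n`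
(values in `[0,1]`, harmonic off `T_n ∪ B_n`, real energies `≤ E`), conjugates `h'_n` based at
the square of `c⋆ = xs + ys i ∈ Ω`, converging locally uniformly on `Ω` to `u`. For every `D > 0`
there is a radius `r_a > 0` such that for every boundary point `q = boundary s₀` at distance
`≥ D` from the arcs `0 ∪ 2`: the common virtual value `c_n` of the exits near `q`
(`faceExitVal_eq_faceExitVal`) converges to a number `U`, `u(w) → U` as `w → q` in `Ω` (by the weak
Beurling estimate for the conjugate, `abs_facePot_sub_exitVal_le`), every exit at level `n`
whose outer square contains a frontier point within `r_a` of `q` has virtual value `c_n`, and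
some such exit lies within `r_a / 2` of `q`. [cite: GeorgakopoulosPanagiotis2019, §3 and Lemma 4.8 (dual form)] -/
theorem exists_boundary_value' (R : ConformalRectangle) {δs : ℕ → ℝ} (hδ : ∀ n, 0 < δs n) (hδ0 : Tendsto δs atTop (𝓝 0)) {h : ℕ → Site 2 → ℝ}
    (h01 : ∀ n x, h n x ∈ Icc (0 : ℝ) 1)
    (hharm : ∀ n x, x ∉ discreteArc R.carrier (δs n) (R.arc 0) → x ∉ discreteArc R.carrier (δs n) (R.arc 2) →
      ∑ y ∈ ((zdGraph 2).neighborFinset x).filter (fun y => (discreteDomainGraph R.carrier (δs n)).Adj x y), (h n y - h n x) = 0)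
    {E : ℝ} (hEn : ∀ᶠ n in atTop, ∑ e ∈ (edgeSet_discreteDomainGraph_finite R.isBounded (hδ n)).toFinset, sqIncr (h n) e ≤ E)
    {xs ys : ℝ} (hc : (⟨xs, ys⟩ : ℂ) ∈ R.carrier) {u : ℂ → ℝ}
    (hconv : ∀ z ∈ R.carrier, ∃ s > 0, TendstoUniformlyOn
      (fun n w => facePot R.carrier (δs n) (h n) ![⌊xs / δs n⌋, ⌊ys / δs n⌋] (nearestSite (δs n) w)) u atTop (ball z s))
    {D : ℝ} (hD : 0 < D) :
    ∃ ra > 0, ∀ s₀ : ℝ, (∀ y ∈ R.arc 0 ∪ R.arc 2, D ≤ dist (R.boundary s₀) y) →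
      ∃ (U : ℝ) (c : ℕ → ℝ), Tendsto c atTop (𝓝 U) ∧
        (∀ η > 0, ∃ r > 0, ∀ w ∈ R.carrier, dist w (R.boundary s₀) < r → |u w - U| ≤ η) ∧
        (∀ᶠ n in atTop, ∀ p p' : Site 2, (faceGraph R.carrier (δs n)).Reachable ![⌊xs / δs n⌋, ⌊ys / δs n⌋] p →
          (zdGraph 2).Adj p p' → ¬ (faceGraph R.carrier (δs n)).Reachable ![⌊xs / δs n⌋, ⌊ys / δs n⌋] p' →
          (∃ j ∈ closedSq (δs n) p', j ∈ frontier R.carrier ∧ dist j (R.boundary s₀) < ra) →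
          faceExitVal R.carrier (δs n) (h n) ![⌊xs / δs n⌋, ⌊ys / δs n⌋] p p' = c n) ∧
        (∀ᶠ n in atTop, ∃ p p' : Site 2, (faceGraph R.carrier (δs n)).Reachable ![⌊xs / δs n⌋, ⌊ys / δs n⌋] p ∧
          (zdGraph 2).Adj p p' ∧ ¬ (faceGraph R.carrier (δs n)).Reachable ![⌊xs / δs n⌋, ⌊ys / δs n⌋] p' ∧
          (∃ j ∈ closedSq (δs n) p', j ∈ frontier R.carrier ∧ dist j (R.boundary s₀) < ra / 2) ∧
          faceExitVal R.carrier (δs n) (h n) ![⌊xs / δs n⌋, ⌊ys / δs n⌋] p p' = c n) := by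
  have hΩo : IsOpen R.carrier := R.isOpen
  have hfrΩ : ∀ z ∈ frontier R.carrier, z ∉ R.carrier := fun z hz hzΩ =>
    Set.disjoint_left.1 R.disjoint_carrier_frontier hzΩ hz
  -- ### constants depending only on `D`
  set ε : ℝ := D / 2 with hε
  have hεpos : 0 < ε := by positivity
  obtain ⟨ρ₀, hρ₀, hULC₀⟩ := SquareTiling.JordanDomain.exists_joinedIn_exterior_diff_closedBall R.toJordanDomain hεpos
  set ρ : ℝ := min ρ₀ ε with hρ
  have hρpos : 0 < ρ := by positivity
  have hρε : ρ ≤ ε := min_le_right _ _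
  have hULC : ∀ (s₀ : ℝ) (e y : ℂ), e ∈ (closure R.carrier)ᶜ → y ∈ (closure R.carrier)ᶜ →
      ε ≤ dist e (R.boundary s₀) → ε ≤ dist y (R.boundary s₀) →
      JoinedIn ((closure R.carrier)ᶜ \ closedBall (R.boundary s₀) ρ) e y := by
    intro s₀ e y he hy hεe hεy
    exact (hULC₀ s₀ e y he hy hεe hεy).mono (sdiff_subset_sdiff_right (closedBall_subset_closedBall (min_le_left _ _)))
  obtain ⟨ra, hrapos, hra16, hulcR⟩ := exists_ulc_radius R hρpos
  have hraρ : ra ≤ ρ / 2 := by linarith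
  refine ⟨ra, hrapos, fun s₀ hDq => ?_⟩
  set q := R.boundary s₀ with hq
  have hqfr : q ∈ frontier R.carrier := R.boundary_mem_frontier s₀
  -- the Beurling constant
  set KE : ℝ := (1 + 8 * Real.sqrt E) * beurlingConst with hKE
  have hKEpos : 0 < KE := by have := beurlingConst_pos; rw [hKE]; positivity
  -- a point of `Ω` very close to `q`, and the reachability of squares near it
  obtain ⟨z', hz'Ω, hz'q⟩ : ∃ z' ∈ R.carrier, dist z' q < ra / 40 := by
    have : q ∈ closure R.carrier := frontier_subset_closure hqfr
    obtain ⟨z', hz', hd⟩ := Metric.mem_closure_iff.1 this (ra / 40) (by positivity)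
    exact ⟨z', hz', by rwa [_root_.dist_comm]⟩
  obtain ⟨sr, hsr, δr, hδr, Hr⟩ := exists_forall_reachable_near R hc hz'Ω
  -- ### eventually (in `n`): the discrete data at `q`
  -- the mesh is small
  have hsmall : ∀ᶠ n in atTop, δs n < min (min δr (ra / 200)) (min sr (ρ / 12)) :=
    (tendsto_order.1 hδ0).2 _ (by positivity)
  -- notation
  set p₀ : ℕ → Site 2 := fun n => ![⌊xs / δs n⌋, ⌊ys / δs n⌋] with hp₀
  set Rb : ℕ → ℕ := fun n => ⌊ra / (5 * δs n)⌋₊ - 6 with hRb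
  have hTsub : ∀ n, discreteArc R.carrier (δs n) (R.arc 0) ⊆ meshBoundary R.carrier (δs n) := fun n x hx => hx.1
  have hBsub : ∀ n, discreteArc R.carrier (δs n) (R.arc 2) ⊆ meshBoundary R.carrier (δs n) := fun n x hx => hx.1
  -- the good levels
  have hgood : ∀ᶠ n in atTop, IsInnerFace R.carrier (δs n) (p₀ n) ∧
      (∀ x : Site 2, meshPoint (δs n) x ∈ ball z' sr → IsInnerFace R.carrier (δs n) x ∧ (faceGraph R.carrier (δs n)).Reachable (p₀ n) x) ∧
      δs n < ra / 200 ∧ δs n < ρ / 12 ∧ δs n < sr ∧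
      ∑ e ∈ (edgeSet_discreteDomainGraph_finite R.isBounded (hδ n)).toFinset, sqIncr (h n) e ≤ E := by
    filter_upwards [hsmall, hEn] with n hn hEn'
    have h1 : δs n < δr := hn.trans_le ((min_le_left _ _).trans (min_le_left _ _))
    have h2 : δs n < ra / 200 := hn.trans_le ((min_le_left _ _).trans (min_le_right _ _))
    have h3 : δs n < sr := hn.trans_le ((min_le_right _ _).trans (min_le_left _ _))
    have h4 : δs n < ρ / 12 := hn.trans_le ((min_le_right _ _).trans (min_le_right _ _))
    exact ⟨(Hr _ (hδ n) h1).1, (Hr _ (hδ n) h1).2, h2, h4, h3, hEn'⟩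
  -- canonical exits at the good levels
  have hexit : ∀ n, (IsInnerFace R.carrier (δs n) (p₀ n) ∧
      (∀ x : Site 2, meshPoint (δs n) x ∈ ball z' sr → IsInnerFace R.carrier (δs n) x ∧ (faceGraph R.carrier (δs n)).Reachable (p₀ n) x) ∧
      δs n < ra / 200 ∧ δs n < ρ / 12 ∧ δs n < sr ∧
      ∑ e ∈ (edgeSet_discreteDomainGraph_finite R.isBounded (hδ n)).toFinset, sqIncr (h n) e ≤ E) →
      ∃ p₁ n₁ : Site 2, (faceGraph R.carrier (δs n)).Reachable (p₀ n) p₁ ∧ (zdGraph 2).Adj p₁ n₁ ∧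
        ¬ (faceGraph R.carrier (δs n)).Reachable (p₀ n) n₁ ∧
        (∃ j ∈ closedSq (δs n) n₁, j ∈ frontier R.carrier) ∧
        (∀ w ∈ closedSq (δs n) p₁, dist w q ≤ ra / 40 + δs n + 4 * δs n) ∧
        (∀ w ∈ closedSq (δs n) n₁, dist w q ≤ ra / 40 + δs n + 4 * δs n) := by
    rintro n ⟨hp, Hr', -, -, hsr', -⟩
    have hx₀ : meshPoint (δs n) (nearestSite (δs n) z') ∈ ball z' sr := by
      rw [Metric.mem_ball]; exact (dist_meshPoint_nearestSite_le (hδ n) z').trans_lt hsr'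
    refine exists_exit_near' R (hδ n) hp (Hr' _ hx₀).2 hqfr ?_
    linarith [dist_triangle (meshPoint (δs n) (nearestSite (δs n) z')) z' q, dist_meshPoint_nearestSite_le (hδ n) z']
  choose! p₁ n₁ hp₁F hadj₁ hn₁F hj₁ hp₁near hn₁near using hexit
  set c : ℕ → ℝ := fun n => faceExitVal R.carrier (δs n) (h n) (p₀ n) (p₁ n) (n₁ n) with hcdef
  -- ### (3): all exits near `q` have the value `c n`
  have hfar : ∀ n, δs n < ra / 200 → ∀ x ∈ discreteArc R.carrier (δs n) (R.arc 0) ∪ discreteArc R.carrier (δs n) (R.arc 2),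
      ε + 3 * δs n ≤ dist (meshPoint (δs n) x) q := by
    intro n hn x hx
    have hx' : ∃ t ∈ R.arc 0 ∪ R.arc 2, dist (meshPoint (δs n) x) t ≤ δs n := by
      rcases hx with hx | hx
      · obtain ⟨t, ht, hd⟩ := exists_dist_le_of_mem_discreteArc R.isOpen (R.isCompact_arc 0) ⟨R.pt 0, R.pt_mem_arc_self 0⟩ hx
        exact ⟨t, Or.inl ht, by rwa [abs_of_pos (hδ n)] at hd⟩
      · obtain ⟨t, ht, hd⟩ := exists_dist_le_of_mem_discreteArc R.isOpen (R.isCompact_arc 2) ⟨R.pt 2, R.pt_mem_arc_self 2⟩ hx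
        exact ⟨t, Or.inr ht, by rwa [abs_of_pos (hδ n)] at hd⟩
    obtain ⟨t, ht, hd⟩ := hx'
    have := hDq t ht
    have hraD : ra ≤ D / 4 := by
      have : ρ ≤ ε := hρε
      linarith [hraρ]
    linarith [dist_triangle q (meshPoint (δs n) x) t, dist_comm q (meshPoint (δs n) x)]
  have h3 : ∀ᶠ n in atTop, ∀ p p' : Site 2, (faceGraph R.carrier (δs n)).Reachable (p₀ n) p →
      (zdGraph 2).Adj p p' → ¬ (faceGraph R.carrier (δs n)).Reachable (p₀ n) p' →
      (∃ j ∈ closedSq (δs n) p', j ∈ frontier R.carrier ∧ dist j q < ra) →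
      faceExitVal R.carrier (δs n) (h n) (p₀ n) p p' = c n := by
    filter_upwards [hgood] with n hn p p' hpF hpp' hp'F hj
    have hg := hn
    obtain ⟨hp0, Hr', hnra, hnρ, hnsr, hEn'⟩ := hn
    obtain ⟨j, hjsq, hjfr, hjq⟩ := hj
    obtain ⟨j₁, hj₁sq, hj₁fr⟩ := hj₁ n hg
    have hj₁q : dist j₁ q < ra := by
      have := hn₁near n hg j₁ hj₁sq; linarith
    -- the flux-free walk between the outer squares of the two exits, through the exterior
    have hfar' : ∀ x ∈ discreteArc R.carrier (δs n) (R.arc 0) ∪ discreteArc R.carrier (δs n) (R.arc 2),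
        ε + 3 * δs n ≤ dist (meshPoint (δs n) x) (R.boundary s₀) := hfar n hnra
    have hδra : δs n ≤ ra := by linarith
    have hinner : ∀ {y : Site 2}, (faceGraph R.carrier (δs n)).Reachable (p₀ n) y → IsInnerFace R.carrier (δs n) y :=
      fun hy => by obtain ⟨W⟩ := hy; exact isInnerFace_of_mem_support' hp0 W (Walk.end_mem_support _)
    have hnotinner : ∀ {y y' : Site 2}, (faceGraph R.carrier (δs n)).Reachable (p₀ n) y → (zdGraph 2).Adj y y' →
        ¬ (faceGraph R.carrier (δs n)).Reachable (p₀ n) y' → ¬ IsInnerFace R.carrier (δs n) y' :=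
      fun hy hyy' hy' hI => hy' (hy.trans (faceGraph_adj_iff.2 ⟨hyy', hinner hy, hI⟩).reachable)
    obtain ⟨ω, hω0, hωs⟩ := exists_fluxFree_walk_near R (hδ n) (h n) (q := q) hra16 hδra (hulcR (hδ n) hδra q)
      (hinner hpF) hpp' (hnotinner hpF hpp' hp'F) (hinner (hp₁F n hg)) (hadj₁ n hg) (hnotinner (hp₁F n hg) (hadj₁ n hg) (hn₁F n hg))
      ⟨j, hjsq, hjq⟩ ⟨j₁, hj₁sq, hj₁q⟩
    exact faceExitVal_eq_faceExitVal R (hδ n) (hTsub n) (hBsub n) (hharm n) hp0 hεpos hρε (hULC s₀) hfar' hpF hpp'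
      (hp₁F n hg) (hadj₁ n hg) ω hω0 hωs
  -- ### (4): the canonical exit is within `ra / 2` of `q`
  have h4 : ∀ᶠ n in atTop, ∃ p p' : Site 2, (faceGraph R.carrier (δs n)).Reachable (p₀ n) p ∧
      (zdGraph 2).Adj p p' ∧ ¬ (faceGraph R.carrier (δs n)).Reachable (p₀ n) p' ∧
      (∃ j ∈ closedSq (δs n) p', j ∈ frontier R.carrier ∧ dist j q < ra / 2) ∧
      faceExitVal R.carrier (δs n) (h n) (p₀ n) p p' = c n := by
    filter_upwards [hgood] with n hn
    obtain ⟨hp0, Hr', hnra, hnρ, hnsr, hEn'⟩ := hn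
    obtain ⟨j₁, hj₁sq, hj₁fr⟩ := hj₁ n ⟨hp0, Hr', hnra, hnρ, hnsr, hEn'⟩
    refine ⟨p₁ n, n₁ n, hp₁F n ⟨hp0, Hr', hnra, hnρ, hnsr, hEn'⟩, hadj₁ n ⟨hp0, Hr', hnra, hnρ, hnsr, hEn'⟩,
      hn₁F n ⟨hp0, Hr', hnra, hnρ, hnsr, hEn'⟩, ⟨j₁, hj₁sq, hj₁fr, ?_⟩, rfl⟩
    have := hn₁near n ⟨hp0, Hr', hnra, hnρ, hnsr, hEn'⟩ j₁ hj₁sq; linarith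
  -- ### the weak Beurling bound near `q`
  have hext : ∀ n, ∃ e : ℂ, e ∈ (closure R.carrier)ᶜ ∧ dist e q < δs n / 2 := fun n => by
    obtain ⟨e, he, hd⟩ := Metric.mem_closure_iff.1 (R.frontier_subset_closure_exterior' hqfr) (δs n / 2) (by have := hδ n; positivity)
    exact ⟨e, he, by rwa [_root_.dist_comm]⟩
  choose e he heq using hext
  have hα := beurlingExp_pos
  have hkey : ∀ θ : ℝ, 0 < θ → θ ≤ 1 → ∃ r > 0, ∀ᶠ n in atTop, ∀ z : Site 2,
      (faceGraph R.carrier (δs n)).Reachable (p₀ n) z → dist (meshPoint (δs n) z) q ≤ r →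
      |facePot R.carrier (δs n) (h n) (p₀ n) z - c n| ≤ KE * θ ^ beurlingExp := by
    intro θ hθ hθ1
    refine ⟨θ * ra / 100, by positivity, ?_⟩
    filter_upwards [hgood, (tendsto_order.1 hδ0).2 _ (by positivity : (0 : ℝ) < θ * ra / 100)] with n hn hnθ z hzF hzq
    have hg := hn
    obtain ⟨hp0, Hr', hnra, hnρ, hnsr, hEn'⟩ := hn
    have hδra : δs n ≤ ra := by linarith
    have hraρ' : ra + 3 * δs n ≤ ρ - 4 * δs n := by linarith
    exact abs_facePot_sub_faceExitVal_le_of_near R (hδ n) (hharm n) (h01 n) hp0 hEn' hεpos hρε (hULC s₀)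
      (hulcR (hδ n) hδra q) hraρ' (hfar n hnra) hrapos hnra (hp₁F n hg) (hadj₁ n hg) (hn₁F n hg)
      (fun w hw => by have := hp₁near n hg w hw; linarith) (he n) (heq n) hθ hθ1 hnθ hzF hzq
  -- ### for every `η > 0`: eventually `|h'_n(nearestSite w) - c n| ≤ η` for `w ∈ Ω` close to `q`
  have hkey' : ∀ η : ℝ, 0 < η → ∃ r > 0, ∀ w ∈ R.carrier, dist w q < r → ∀ᶠ n in atTop,
      |facePot R.carrier (δs n) (h n) (p₀ n) (nearestSite (δs n) w) - c n| ≤ η := by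
    intro η hη
    set θ : ℝ := min 1 ((η / KE) ^ beurlingExp⁻¹) with hθ
    have hθpos : 0 < θ := by rw [hθ]; positivity
    have hθ1 : θ ≤ 1 := min_le_left _ _
    have hθη : KE * θ ^ beurlingExp ≤ η := by
      have h1 : θ ^ beurlingExp ≤ ((η / KE) ^ beurlingExp⁻¹) ^ beurlingExp :=
        Real.rpow_le_rpow hθpos.le (min_le_right _ _) hα.le
      rw [Real.rpow_inv_rpow (by positivity) hα.ne'] at h1
      calc KE * θ ^ beurlingExp ≤ KE * (η / KE) := mul_le_mul_of_nonneg_left h1 hKEpos.le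
        _ = η := by field_simp
    obtain ⟨r, hr, hb⟩ := hkey θ hθpos hθ1
    refine ⟨r / 2, by positivity, fun w hw hwq => ?_⟩
    obtain ⟨sw, hsw, δw, hδw, Hw⟩ := exists_forall_reachable_near R hc hw
    filter_upwards [hb, (tendsto_order.1 hδ0).2 _ (lt_min hδw (lt_min hsw (half_pos hr)))] with n hn hd
    have hd1 : δs n < δw := hd.trans_le (min_le_left _ _)
    have hd2 : δs n < sw := hd.trans_le ((min_le_right _ _).trans (min_le_left _ _))
    have hd3 : δs n < r / 2 := hd.trans_le ((min_le_right _ _).trans (min_le_right _ _))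
    have hnear := dist_meshPoint_nearestSite_le (hδ n) w
    have hreach := ((Hw _ (hδ n) hd1).2 (nearestSite (δs n) w) (by rw [Metric.mem_ball]; linarith)).2
    refine (hn _ hreach ?_).trans hθη
    linarith [dist_triangle (meshPoint (δs n) (nearestSite (δs n) w)) w q]
  -- pointwise convergence of the conjugates
  have hpt : ∀ w ∈ R.carrier, Tendsto (fun n => facePot R.carrier (δs n) (h n) (p₀ n) (nearestSite (δs n) w)) atTop (𝓝 (u w)) := by
    intro w hw
    obtain ⟨s', hs', hconv'⟩ := hconv w hw
    exact hconv'.tendsto_at (mem_ball_self hs')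
  -- ### (1): `c` is Cauchy
  have hcauchy : CauchySeq c := by
    rw [Metric.cauchySeq_iff]
    intro η hη
    obtain ⟨r, hr, hb⟩ := hkey' (η / 3) (by positivity)
    obtain ⟨w₀, hw₀Ω, hw₀q⟩ : ∃ w₀ ∈ R.carrier, dist w₀ q < r := by
      obtain ⟨w₀, hw₀, hd⟩ := Metric.mem_closure_iff.1 (frontier_subset_closure hqfr) r hr
      exact ⟨w₀, hw₀, by rwa [_root_.dist_comm]⟩
    have hc₀ := (hpt w₀ hw₀Ω).cauchySeq
    rw [Metric.cauchySeq_iff] at hc₀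
    obtain ⟨N₁, hN₁⟩ := hc₀ (η / 3) (by positivity)
    obtain ⟨N₂, hN₂⟩ := eventually_atTop.1 (hb w₀ hw₀Ω hw₀q)
    refine ⟨max N₁ N₂, fun m hm n hn => ?_⟩
    have hm₁ : N₁ ≤ m := (le_max_left _ _).trans hm
    have hn₁ : N₁ ≤ n := (le_max_left _ _).trans hn
    have hm₂ := hN₂ m ((le_max_right _ _).trans hm)
    have hn₂ := hN₂ n ((le_max_right _ _).trans hn)
    have h12 := hN₁ m hm₁ n hn₁
    rw [Real.dist_eq] at h12 ⊢
    rw [abs_sub_comm] at hm₂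
    have e : c m - c n = (c m - facePot R.carrier (δs m) (h m) (p₀ m) (nearestSite (δs m) w₀)) +
        (facePot R.carrier (δs m) (h m) (p₀ m) (nearestSite (δs m) w₀) - facePot R.carrier (δs n) (h n) (p₀ n) (nearestSite (δs n) w₀)) +
        (facePot R.carrier (δs n) (h n) (p₀ n) (nearestSite (δs n) w₀) - c n) := by ring
    rw [e]
    refine (abs_add_three _ _ _).trans_lt ?_
    linarith
  obtain ⟨U, hU⟩ := cauchySeq_tendsto_of_complete hcauchy
  -- ### (2): boundary values of `u`
  have h2 : ∀ η > 0, ∃ r > 0, ∀ w ∈ R.carrier, dist w q < r → |u w - U| ≤ η := by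
    intro η hη
    obtain ⟨r, hr, hb⟩ := hkey' η hη
    refine ⟨r, hr, fun w hw hwq => ?_⟩
    have hlim : Tendsto (fun n => facePot R.carrier (δs n) (h n) (p₀ n) (nearestSite (δs n) w) - c n) atTop (𝓝 (u w - U)) :=
      (hpt w hw).sub hU
    exact le_of_tendsto ((continuous_abs.tendsto _).comp hlim) (hb w hw hwq)
  exact ⟨U, c, hU, h2, h3, h4⟩

end KirchhoffSlope

end Summit.CriticalPhenomena.CardyFormulaZ2.Theorems
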